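import Summits.BirchSwinnertonDyer.BirchSwinnertonDyer.Theorems.AlignedTransportAtTwoMainConjectureTransportAlignedAtTwoNegTwistSymbolShared
import Summits.BirchSwinnertonDyer.BirchSwinnertonDyer.Theorems.AlignedTransportAtTwoMainConjectureTransportAlignedAtTwoNegTwistMeasureShared
import Literature.NumberTheory.EllipticCurves.PAdicLFunctionQuadraticTwistCongruenceAtTwoSharedPrimesProofs
import HarnessLib

/-!
# Route `AlignedTransportAtTwo`, crux C1 `MainConjectureTransportAlignedAtTwo` (stmt-BirchSwinnertonDyer-22296), line `birth` — NEGATIVE twists,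
# core SEMISTABLE at the primes of `d`: the mod-`2` twist congruence `L_A' ≡ v·L_W·∏_{ℓ∣d}𝒫_ℓ (mod 2Λ)` for `A = E^{(d)}`, `d < 0`, `E` good OR
# multiplicative at the primes of `d`, WITH `|d|·(Ω⁺_{f_A})² = c_A²·(Ω⁻_{f_W})²` — the `d < 0` twin of the cell `bsd-2adic` shared-primes congruence
# `exists_iwasawa_twist_congr_two_and_sq_sqfreeAt`, under `IsRhombic f_W`

HONEST FRAMING (cell `bsd-f1-sign2`, lead seat `bsd-line-att-p1` g7). BSD is NOT proved; C1 is NOT closed. THEOREMS ONLY; nothing asserted;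
`--supports stmt-BirchSwinnertonDyer-22296 --as helper`. The companion of `…NegTwistCongruence.lean` (core GOOD at `d`) for cores that may be
MULTIPLICATIVE at primes of `d` (`ℓ ∥ N_E`): symbol step `…NegTwistSymbolShared` (cusp class of `1/g`), transform step `…NegTwistMeasureShared`
(`‖μ_{f,α,m}‖₂ ≤ 2` from `norm_msdMeasureTame_unitRoot_two_le_two_sqfreeAt`), depletion half `exists_iwasawa_padicLFunctionTame_one_congr_two_sqfreeAt`
(`𝒫_ℓ = 1 ∓ ℓ⁻¹(1+T)^{f_ℓ}` at the multiplicative places).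

* `exists_iwasawa_twist_congr_two_and_sq_of_neg_sqfreeAt`.

References: [Matsuno2000] Thm. 3.1, Lemmas 3.2–3.3 (pp. 86–88); [MazurTateTeitelbaum1986Invent] §I.8, §I.13; [Shimura1971] Prop. 3.64;
[Manin1972] Prop. 1.4; [GreenbergVatsal2000] §1 (8)–(9), §2 Prop. (2.4).
-/

set_option autoImplicit false
set_option linter.dupNamespace false

noncomputable section

open scoped Classical MatrixGroups ModularForm NumberTheorySymbols

open CongruenceSubgroup Filter Topology NumberField IsDedekindDomain WeierstrassCurve PowerSeries Rat.HeightOneSpectrum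
open Literature.NumberTheory.EllipticCurves Literature.NumberTheory.EllipticCurves.ModularForms
  Literature.NumberTheory.EllipticCurves.GreenbergVatsal2000
open Summit.BirchSwinnertonDyer.Rank1Residual.F1Sign2
open Summit.BirchSwinnertonDyer.BirchSwinnertonDyer.Theorems.AlignedTransportAtTwoNegTwistSymbol
open Summit.BirchSwinnertonDyer.BirchSwinnertonDyer.Theorems.AlignedTransportAtTwoNegTwistSymbolShared
open Summit.BirchSwinnertonDyer.BirchSwinnertonDyer.Theorems.AlignedTransportAtTwoNegTwistMeasureShared

namespace Summit.BirchSwinnertonDyer.BirchSwinnertonDyer.Theorems.AlignedTransportAtTwoNegTwistCongruenceShared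

section TwoAdic

variable (W : WeierstrassCurve ℚ) [W.IsElliptic] [W.IsGloballyMinimal] {d : ℤ} {A : WeierstrassCurve ℚ}
  [A.IsElliptic] [A.IsGloballyMinimal]
  [NeZero (W.conductorNorm ℤ)] [NeZero (A.conductorNorm ℤ)]
  {fW : CuspForm (Gamma0 (W.conductorNorm ℤ)) 2} {fA : CuspForm (Gamma0 (A.conductorNorm ℤ)) 2}

omit [W.IsElliptic] [W.IsGloballyMinimal] [NeZero (W.conductorNorm ℤ)] [A.IsElliptic] [A.IsGloballyMinimal]
  [NeZero (A.conductorNorm ℤ)] in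
/-- Distinct finite places of `ℚ` lie over distinct primes; private helper. [folklore] -/
private theorem natGenerator_injective_rat' :
    Function.Injective (Rat.HeightOneSpectrum.natGenerator (R := 𝓞 ℚ)) := fun _ _ h ↦
  (Rat.HeightOneSpectrum.primesEquiv (R := 𝓞 ℚ)).injective (Subtype.ext h)

omit [W.IsElliptic] [W.IsGloballyMinimal] [NeZero (W.conductorNorm ℤ)] [A.IsElliptic] [A.IsGloballyMinimal]
  [NeZero (A.conductorNorm ℤ)] in
/-- `toZMod(2) = 0` in `ℤ/2`, so `C(2)·E ≡ 0 (mod 2)`; private helper. [folklore] -/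
private theorem map_toZMod_C_two_mul (E : IwasawaAlgebra 2) :
    PowerSeries.map (PadicInt.toZMod (p := 2)) (PowerSeries.C (2 : ℤ_[2]) * E) = 0 := by
  rw [map_mul, PowerSeries.map_C, map_ofNat, show (2 : ZMod 2) = 0 from rfl, map_zero, zero_mul]

/-- **The mod-`2` twist congruence at a good ordinary `2` for a NEGATIVE twist, core SEMISTABLE at `d`, WITH the period size of the constant**
(`d < 0` twin of the tree's `exists_iwasawa_twist_congr_two_and_sq_sqfreeAt`). For `E = W/ℚ` globally minimal, good ordinary at `2`, whose newform
`f_W` has RHOMBIC period lattice, `d < 0`, `d ≡ 1 (mod 4)` square-free with `E` GOOD OR MULTIPLICATIVE at every prime of `d`,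
`A` a globally minimal model of `E^{(d)}`, newforms `f_W`, `f_A`, and `S₀` the set of places over the primes of `d`: there are
`L_W, L_A' ∈ Λ = ℤ₂⟦T⟧`, `c_A ∈ ℚˣ`, `v ∈ Λˣ` with `ι L_W = L₂(f_W, α_W)`, `ι L_A' = C(c_A)·L₂(f_A, α_A)`, `L_A' ≡ v·L_W·∏_{v∈S₀}𝒫_v (mod 2Λ)`
AND `|d|·(Ω⁺_{f_A})² = c_A²·(Ω⁻_{f_W})²` (`c_A = c⁻¹` for the odd Birch constant `c`, `c²·|d|·(Ω⁺_{f_A})² = (Ω⁻_{f_W})²`). Ingredients: odd Birch relation without `(d, N) = 1` + the rhombic congruence relative to `1/g`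
(`exists_int_ratPlusSymbol_twist_eq_sum_plus_add_sqfreeAt`), transform congruence (`exists_padicLFunction_twist_eq_add_two_mul_shared` with
`norm_msdMeasureTame_unitRoot_two_le_two_sqfreeAt`), depletion half (`exists_iwasawa_padicLFunctionTame_one_congr_two_sqfreeAt`), `α_A = χ_d(2)α_W`.
[cite: Matsuno2000, Lemmas 3.2–3.3 and proof of Theorem 3.1 (pp. 86–88)] [cite: MazurTateTeitelbaum1986Invent, §I.8, §I.13] [cite: Shimura1971, Prop. 3.64] -/
theorem exists_iwasawa_twist_congr_two_and_sq_of_neg_sqfreeAt (hd : d < 0) (hd4 : d % 4 = 1) (hsq : Squarefree d)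
    (hred : ∀ v : HeightOneSpectrum (𝓞 ℚ), ((primesEquiv v : ℕ) : ℤ) ∣ d →
      W.HasGoodReductionAt v ∨ W.HasMultiplicativeReductionAt v)
    {C : VariableChange ℚ}
    (hA : C • W.quadraticTwist (d : ℚ) = A) (hfW : IsNewformOf W fW) (hfA : IsNewformOf A fA)
    (hord : IsOrdinaryAt W 2) (hrh : IsRhombic fW) (S₀ : Finset (HeightOneSpectrum (𝓞 ℚ)))
    (hS₀ : S₀.image Rat.HeightOneSpectrum.natGenerator = d.natAbs.primeFactors) :
    ∃ (LW LA' : IwasawaAlgebra 2) (cA : ℚ) (v : (IwasawaAlgebra 2)ˣ),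
      iwasawaToPowerSeries 2 LW = padicLFunction fW (unitRoot W 2 : ℚ_[2]) ∧ cA ≠ 0 ∧
      iwasawaToPowerSeries 2 LA' = PowerSeries.C (cA : ℚ_[2]) * padicLFunction fA (unitRoot A 2 : ℚ_[2]) ∧
      PowerSeries.map (PadicInt.toZMod (p := 2)) LA' =
        PowerSeries.map (PadicInt.toZMod (p := 2)) ((v : IwasawaAlgebra 2) * LW * eulerFactorProduct W 2 S₀) ∧
      (d.natAbs : ℝ) * plusPeriod fA ^ 2 = (cA : ℝ) ^ 2 * minusPeriod fW ^ 2 := by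
  have hd0 : d ≠ 0 := hd.ne
  haveI : NeZero d.natAbs := ⟨Int.natAbs_ne_zero.mpr hd0⟩
  set m : ℕ := d.natAbs with hmdef
  have hsq' : Squarefree m := Int.squarefree_natAbs.mpr hsq
  have hm4 : m % 4 = 3 := by omega
  have hd2 : ¬ (2 : ℤ) ∣ d := by omega
  have hm2 : m.Coprime 2 := by
    rw [Nat.coprime_two_right, Nat.odd_iff]; omega
  have h2N : ¬ 2 ∣ W.conductorNorm ℤ := not_dvd_level_of_isNewformOf hfW hord.1
  -- `N` is square-free at the primes of `m` (good: `ℓ ∤ N`; multiplicative: `ℓ ∥ N`)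
  have hmN' : ∀ ℓ : ℕ, ℓ.Prime → ℓ ∣ m → ¬ ℓ ^ 2 ∣ W.conductorNorm ℤ := by
    intro ℓ hℓ hℓm
    obtain ⟨v, hvℓ⟩ : ∃ v : HeightOneSpectrum (𝓞 ℚ), (primesEquiv v : ℕ) = ℓ :=
      ⟨primesEquiv.symm ⟨ℓ, hℓ⟩, by rw [Equiv.apply_symm_apply]⟩
    subst hvℓ
    haveI : Fact (primesEquiv v : ℕ).Prime := ⟨hℓ⟩
    have hℓd : ((primesEquiv v : ℕ) : ℤ) ∣ d := by
      rw [hmdef] at hℓm; exact Int.natCast_dvd.mpr hℓm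
    rcases hred v hℓd with hg | hmu
    · exact fun h ↦ (not_dvd_level_of_isNewformOf hfW
        ((hasGoodReductionAtPrime_iff_hasGoodReductionAt_ringOfIntegers v W).mpr hg)) ((dvd_pow_self _ two_ne_zero).trans h)
    · exact (hfW.dvd_level_and_not_sq_dvd_of_multiplicative
        ((W.hasMultiplicativeReductionAtPrime_iff_hasMultiplicativeReductionAt_ringOfIntegers v).mpr hmu)).2.1
  -- the Jacobi character `χ_d` mod `m = |d|`
  obtain ⟨χ, hχ⟩ := exists_mulChar_int_eq_jacobiSym m
  set χℚ : MulChar (ZMod m) ℚ := χ.ringHomComp (Int.castRingHom ℚ) with hχℚ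
  have hodd : χ (-1) = -1 := mulChar_jacobi_apply_neg_one_of_three hχ hm4
  have hχ2 : χℚ (2 : ZMod m) ^ 2 = 1 := by
    have h := mulChar_jacobi_apply_natCast_sq hχ 2 (Nat.coprime_comm.mp hm2)
    rw [Nat.cast_ofNat] at h
    rw [hχℚ, MulChar.ringHomComp_apply, ← map_pow, h, map_one]
  have hχv : ∀ b : ZMod m, IsUnit b → χℚ b ^ 2 = 1 := fun b hb ↦ by
    rw [hχℚ, MulChar.ringHomComp_apply, ← map_pow, mulChar_jacobi_apply_sq_of_isUnit hχ hb, map_one]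
  -- odd Birch with the period constant, and the rhombic shortcut
  obtain ⟨c, hB, hper⟩ := exists_ratPlusSymbol_twist_eq_sum_odd_and_sq_sqfreeAt W hd hd4 hsq hred hA hfW hfA hχ
  have hxA : ∃ x : ℚ, ratPlusSymbol fA x ≠ 0 := exists_ratPlusSymbol_ne_zero hfA.1 hfA.coeffField_eq_bot
  have hc0 : c ≠ 0 := by
    rintro rfl
    obtain ⟨x, hx⟩ := hxA
    exact hx (by rw [hB x, zero_mul])
  have hBk : ∀ x : ℚ, Nat.Coprime x.den (m * W.conductorNorm ℤ) →
      ∃ k : ℤ, ratPlusSymbol fA x = c * (∑ b : ZMod m, χℚ b * ratPlusSymbol fW (x + (b.val : ℚ) / m) + k) :=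
    fun x hx ↦ exists_int_ratPlusSymbol_twist_eq_sum_plus_add_sqfreeAt fW fA hfW.1 hfW.coeffField_eq_bot hrh hmN' χ hodd hB x hx
  -- unit roots: `α_A = χ(2)·α_W`
  obtain ⟨hαeq, hαu, -⟩ := unitRoot_coe_spec (W := W) hord
  have hap : cuspCoeff fW 2 = ((W.frobeniusTrace 2 : ℤ) : ℂ) := cuspCoeff_eq_frobeniusTrace_of_isNewformOf_holds hfW hord.1
  obtain ⟨hordA, hαA⟩ := isOrdinaryAt_twist_and_unitRoot_eq_sqfreeAt W 2 hd4 hsq hred hA hord hd2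
  have hαA' : (unitRoot A 2 : ℚ_[2]) = ((χℚ (2 : ZMod m) : ℚ) : ℚ_[2]) * (unitRoot W 2 : ℚ_[2]) := by
    have h2 : χℚ (2 : ZMod m) = (J((2 : ℤ) | m) : ℚ) := by
      rw [hχℚ, MulChar.ringHomComp_apply, ← Nat.cast_ofNat, mulChar_jacobi_apply_natCast hχ 2, eq_intCast, Nat.cast_ofNat]
    rw [hαA, h2]
    push_cast
    rfl
  have hTg : ∀ k : ℕ, Tendsto (padicLRiemannSum fA (((χℚ (2 : ZMod m) : ℚ) : ℚ_[2]) * (unitRoot W 2 : ℚ_[2])) k) atTop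
      (𝓝 (padicLCoeff fA (((χℚ (2 : ZMod m) : ℚ) : ℚ_[2]) * (unitRoot W 2 : ℚ_[2])) k)) := by
    intro k
    obtain ⟨hαAeq, hαAu, -⟩ := unitRoot_coe_spec (W := A) hordA
    rw [← hαA']
    exact tendsto_padicLRiemannSum_holds (f := fA) (p := 2) hfA.1 hfA.coeffField_eq_bot (not_dvd_level_of_isNewformOf hfA hordA.1)
      (cuspCoeff_eq_frobeniusTrace_of_isNewformOf_holds hfA hordA.1) hαAeq hαAu k
  -- the transform congruence `L₂(f_A, α_A) = C(c)·B·L₂(f_W, m, α_W, 𝟙) + C(2c)·ι(E)`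
  have hμ := norm_msdMeasureTame_unitRoot_two_le_two_sqfreeAt (m := m) hord hfW hmN'
  obtain ⟨E, hE⟩ := exists_padicLFunction_twist_eq_add_two_mul_shared fW fA hfW.1 hfW.coeffField_eq_bot h2N hm2 hap hαeq hαu hμ
    χℚ hχ2 hχv hBk hTg
  rw [← hαA'] at hE
  -- the depletion half
  have hS2 : ∀ v ∈ S₀, Rat.HeightOneSpectrum.natGenerator v ≠ 2 := by
    intro v hv h
    have hmem : Rat.HeightOneSpectrum.natGenerator v ∈ d.natAbs.primeFactors := hS₀ ▸ Finset.mem_image_of_mem _ hv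
    rw [h] at hmem
    exact hd2 (Int.natCast_dvd.mpr (Nat.dvd_of_mem_primeFactors hmem))
  have hredS : ∀ v ∈ S₀, W.HasGoodReductionAt v ∨ W.HasMultiplicativeReductionAt v := by
    intro v hv
    have hmem : Rat.HeightOneSpectrum.natGenerator v ∈ d.natAbs.primeFactors := hS₀ ▸ Finset.mem_image_of_mem _ hv
    exact hred v (Int.natCast_dvd.mpr (Nat.dvd_of_mem_primeFactors hmem))
  have hm : m = ∏ v ∈ S₀, Rat.HeightOneSpectrum.natGenerator v := by
    have h := Nat.prod_primeFactors_of_squarefree hsq'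
    rw [hmdef] at h ⊢
    rw [← hS₀, Finset.prod_image fun v _ w _ h ↦ natGenerator_injective_rat' h] at h
    exact h.symm
  obtain ⟨LW, G₁, u, hLW, hG₁, hG₁c⟩ := exists_iwasawa_padicLFunctionTame_one_congr_two_sqfreeAt hord hfW S₀ hS2 hredS hm
  -- the unit `(1+T)^{−f_m}` of `Λ` and the integral element `L_A' = B·G₁ + 2E`
  set B : IwasawaAlgebra 2 := PowerSeries.binomialSeries ℤ_[2] (-frobeniusExponent 2 (m : ℤ_[2])) with hBdef
  have hBu : IsUnit B :=
    isUnit_iff_exists_inv.mpr ⟨PowerSeries.binomialSeries ℤ_[2] (frobeniusExponent 2 (m : ℤ_[2])), by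
      rw [hBdef, ← PowerSeries.binomialSeries_add, neg_add_cancel, PowerSeries.binomialSeries_zero]⟩
  have hcQ : (c : ℚ_[2]) ≠ 0 := by exact_mod_cast hc0
  have hperiod : (m : ℝ) * plusPeriod fA ^ 2 = ((c⁻¹ : ℚ) : ℝ) ^ 2 * minusPeriod fW ^ 2 := by
    have hcR : (c : ℝ) ≠ 0 := by exact_mod_cast hc0
    rw [← hper hxA, hmdef]
    push_cast
    field_simp
  refine ⟨LW, B * G₁ + PowerSeries.C (2 : ℤ_[2]) * E, c⁻¹, hBu.unit * u, hLW, inv_ne_zero hc0, ?_, ?_, hperiod⟩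
  · -- `ι(B·G₁ + 2E) = c⁻¹·L₂(f_A, α_A)`
    have hι2 : iwasawaToPowerSeries 2 (PowerSeries.C (2 : ℤ_[2])) = PowerSeries.C (2 : ℚ_[2]) := by
      show PowerSeries.map (algebraMap ℤ_[2] ℚ_[2]) (PowerSeries.C (2 : ℤ_[2])) = _
      rw [PowerSeries.map_C, map_ofNat]
    rw [map_add, map_mul, map_mul, hG₁, hBdef, BurungaleSkinner2023.iwasawaToPowerSeries_binomialSeries, hι2, hE, Rat.cast_inv]
    have h2c : PowerSeries.C (2 * (c : ℚ_[2])) = PowerSeries.C (2 : ℚ_[2]) * PowerSeries.C (c : ℚ_[2]) := by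
      rw [← map_mul]
    rw [h2c, mul_add, ← mul_assoc, ← mul_assoc, ← map_mul, inv_mul_cancel₀ hcQ, map_one, one_mul]
    rw [show PowerSeries.C (c : ℚ_[2])⁻¹ * (PowerSeries.C (2 : ℚ_[2]) * PowerSeries.C (c : ℚ_[2]) * iwasawaToPowerSeries 2 E) =
      (PowerSeries.C (c : ℚ_[2])⁻¹ * PowerSeries.C (c : ℚ_[2])) * (PowerSeries.C (2 : ℚ_[2]) * iwasawaToPowerSeries 2 E) by ring,
      ← map_mul, inv_mul_cancel₀ hcQ, map_one, one_mul]
  · -- `B·G₁ + 2E ≡ (B u)·L_W·∏𝒫 (mod 2)`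
    rw [map_add, map_toZMod_C_two_mul, add_zero, map_mul, hG₁c, ← map_mul, Units.val_mul, IsUnit.unit_spec]
    congr 1
    ring

end TwoAdic

end Summit.BirchSwinnertonDyer.BirchSwinnertonDyer.Theorems.AlignedTransportAtTwoNegTwistCongruenceShared

end
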